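import Summits.QuantumFields.BalabanUV.T4Continuum.Support.BalabanAveragedTowerApply
import Summits.QuantumFields.BalabanUV.T4Continuum.Support.CTVectorPropagatorLevelFree
import Literature.MathematicalPhysics.QuantumFieldTheory.Balaban1983to89.Beta.EffectiveKernel
import Literature.MathematicalPhysics.QuantumFieldTheory.King1986.CovarianceRate

/-!
# Row G-an2-4 ∕ (CONV-C), target ledger (O-pos) — THE `k`-UNIFORM POSITION-SPACE DECAY AND THE DECAY-WEIGHTED CAUCHY RATE OF THE
# UNIT-LATTICE READINGS OF BAŁABAN's (1.18)-AVERAGED FREE COVARIANCE `𝒢 = Δ_a⁻¹` AT `U = 1`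
# (`HOME/beta/ROUTES-GAN24.md` v1 §0 (0.5) «R0», repaired per the located reading L-gan24leaf04-g44-1, GAPS l.36893)

NOT IN PRINT; OUR BOOKKEEPING.  Cell `pub-balaban`, G-an2-4 crux team, leaf seat `b2b-balaban-gan24-formalise-leaf-04` (gen 44).
WHAT IS PROVED (every `d`, `a > 0`; `κ, C` depend on `(d, a)` only, chosen BEFORE the blocking factor `L`, the torus `M`, the level `k`):
 * §1 torus-distance bookkeeping (`circAbs_three_le`; a contour step moves a coordinate class by `≤ t`; BLOCK SEPARATION per
   coordinate from `EffectiveKernel.circAbs_scale`; coordinatewise-to-sup transfer `le_ldist_of_coord`);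
 * §2 SUPPORT of the rows of the composite averaging `Atow QBlev k`, read off NE2-p1's ENTRYWISE identity
   `BalabanAveragedTowerApply.Atow_QBlev_apply` (= [B5] (1.18) bond by bond): row `(x₀, μ)` lives on bonds `(y, μ)` with
   `y − t e_μ ∈ B^{n_k}(x₀)`, `t < n_k`; two rows' supports are `≥ n_k·(ldist(x₀, x₀′) − 3)` apart (`sep_of_inBlock`);
 * §3 the entry of `unitCovB k = (L^d)^k·(Atow 𝒢_k Atowᴴ)` as an `ℓ²` PAIRING of two rows against `𝒢_k`, `‖row‖₂² ≤ ‖Atow‖² ≤ (L^d)^{−k}`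
   (`CovariantAveragingTower.opNorm_Atow_sq_le`) cancelling the prefactor exactly;
 * §4 **`unitCovB_entry_decay`**: `∃ κ C > 0, ∀ L M (2 ≤ M_μ) k e e′, ‖unitCovB L M a k e e′‖ ≤ C·e^{−κ·ldist(e.1, e′.1)}` from the
   substrate's UNCONDITIONAL level-free Combes–Thomas decay `CTVectorPropagatorLevelFree.calG_setDecay_levelFree` (no (1.126)-type
   hypothesis), and **`unitCovB_decayCauchy_of_supCauchy`**: with the SAME `κ, C`, ANY entrywise sup-norm Cauchy rate `ε·θ^k` (rate `θ` a PARAMETER,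
   gan24-idea-1's request) upgrades to `√(2Cε)·(√θ)^k·e^{−(κ/2)·ldist(e.1,e′.1)}` by King's `min ≤ geometric mean`
   (`King1986.CovarianceRate.abs_le_sqrt_mul_exp_half`) — the (O-pos) shape «|𝒦_{k+j} − 𝒦_k|(x,y) ≤ Cθ^k e^{−δ|x−y|}» for ONE constituent;
   the instance `θ = L⁻¹` (NE2-p1's operator-norm rate `opNorm_unitCovB_sub_le`) and the LIMIT kernel are `GAN24/UnitCovDecayRate`;
   decay rate EXISTENTIAL (the substrate sizes its `κ` as astronomically small).
HONEST FRAMING.  `U = 1`, finite tori, the (1.18)-averaged FREE covariance only (NOT `H_k`, NOT the (BF-2) composites, NOT `U ≠ 1`);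
[folklore] bookkeeping over tree modules BY NAME; no `def … : Prop`, nothing printed used as a hypothesis, 0 sorry.  Discharges NOTHING
of (CONV-C) as typed, NEVER «G-an2-4 closed», NOT D1, NOT BetaPertH, NOT the continuum limit, NOT Clay.  HONEST DEPENDENCY: continuum YM
on T⁴ ⇐ BetaPertH ∧ nine spine estimates (0/9 proved); BetaPertH ⇐ (D1) ∧ (D4) ∧ CAP+tail; G-an2-4 gates asym, D1 and NE2/3/4.
-/

noncomputable section

open scoped BigOperators ComplexConjugate Matrix Matrix.Norms.L2Operator
open Finset

namespace Summit.QuantumFields.BalabanUV.Beta.GAN24.UnitCovDecay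

open Literature.MathematicalPhysics.QuantumFieldTheory
open Literature.MathematicalPhysics.QuantumFieldTheory.Balaban1983to89
open B5Prop11Plancherel (Tor fine calG)
open B5Prop11Lower (nsq nsq_nonneg)
open B5Block118 (tstep)
open B5G183RateUnitTower (lev lev_neZero)
open B4TorusKernel.MultiPeriod (circAbs circAbs_le_abs circAbs_nonneg)
open B4Sect5Torus (ccoord tdist circAbs_le_tdist circAbs_add_le circAbs_neg)
open Beta.TorusG0Decay (ldist toSite circAbs_congr)
open Beta.EffectiveKernel (circAbs_scale)
open Summit.QuantumFields.BalabanUV.T4Continuum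
open Summit.QuantumFields.BalabanUV.T4Continuum.CovariantAveragingTower (Atow avgTow opNorm_Atow_sq_le)
open Summit.QuantumFields.BalabanUV.T4Continuum.BalabanAveragedTowerUnit
  (idx QBlev calGlev unitCovB one_le_lev' opNorm_QBlev_sq_le norm_entry_le_opNorm)
open Summit.QuantumFields.BalabanUV.T4Continuum.BalabanAveragedTowerApply (InBlock lineCount Atow_QBlev_apply)

variable {d : ℕ}

/-! ## §1 Torus-distance bookkeeping -/

section Torus

/-- three-term lower triangle inequality for the circular distance: `dist(B) − dist(A) − dist(C) ≤ dist(A + B + C)`.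
[folklore] -/
theorem circAbs_three_le {N : ℕ} (hN : 1 ≤ N) (A B C : ℤ) :
    circAbs N B - circAbs N A - circAbs N C ≤ circAbs N (A + B + C) := by
  have h1 := circAbs_add_le hN (A + B + C) (-A + -C)
  rw [show A + B + C + (-A + -C) = B by ring] at h1
  have h2 := circAbs_add_le hN (-A) (-C)
  rw [circAbs_neg hN, circAbs_neg hN] at h2
  linarith

variable (Nf : Fin d → ℕ) [hNf : ∀ μ, NeZero (Nf μ)]

/-- a straight contour step of parameter `t` moves the `ν`-th coordinate class by `t·[ν = μ]`: the circular distance between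
`y` and `y − t e_μ` in coordinate `ν` is `≤ t`. [folklore] -/
theorem circAbs_val_sub_tstep_le (y : Tor Nf) (μ ν : Fin d) (t : ℕ) :
    circAbs (Nf ν) (((y ν).val : ℤ) - (((y - tstep Nf μ t) ν).val : ℤ)) ≤ t := by
  have hN : 1 ≤ Nf ν := Nat.one_le_iff_ne_zero.mpr (NeZero.ne _)
  have hc : ((((y ν).val : ℤ) - (((y - tstep Nf μ t) ν).val : ℤ) : ℤ) : ZMod (Nf ν))
      = ((if ν = μ then (t : ℤ) else 0 : ℤ) : ZMod (Nf ν)) := by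
    push_cast
    rw [ZMod.natCast_zmod_val, ZMod.natCast_zmod_val]
    simp only [Pi.sub_apply, tstep]
    split_ifs <;> simp
  rw [circAbs_congr hc]
  refine (circAbs_le_abs hN _).trans ?_
  split_ifs <;> simp

variable (M : Fin d → ℕ) [hM : ∀ μ, NeZero (M μ)]

/-- **block separation per coordinate**: if `z ∈ B^n(b)` and `z′ ∈ B^n(b′)` (blocks of the unit torus of periods `1·M`, in
`1/n`-units) then `n·dist_{1·M_ν}(b_ν − b′_ν) − (n − 1) ≤ dist_{n·M_ν}(z_ν − z′_ν)`. [folklore] -/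
theorem block_sep_coord (n : ℕ) (hn : 1 ≤ n) {b b' : Fin d → ℕ} {z z' : Tor (fine n M)}
    (hz : InBlock M n b z) (hz' : InBlock M n b' z') (ν : Fin d) :
    (n : ℤ) * circAbs (fine 1 M ν) ((b ν : ℤ) - (b' ν : ℤ)) - ((n : ℤ) - 1)
      ≤ circAbs (fine n M ν) (((z ν).val : ℤ) - ((z' ν).val : ℤ)) := by
  have hMν : 1 ≤ M ν := Nat.one_le_iff_ne_zero.mpr (NeZero.ne _)
  have e1 : (z ν).val = n * b ν + (z ν).val % n := by rw [← hz ν]; exact (Nat.div_add_mod _ _).symm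
  have e2 : (z' ν).val = n * b' ν + (z' ν).val % n := by rw [← hz' ν]; exact (Nat.div_add_mod _ _).symm
  have hr : (z ν).val % n < n := Nat.mod_lt _ hn
  have hr' : (z' ν).val % n < n := Nat.mod_lt _ hn
  have key := circAbs_scale hMν hn ((b ν : ℤ) - (b' ν : ℤ)) ((((z ν).val % n : ℕ) : ℤ) - (((z' ν).val % n : ℕ) : ℤ))
  have e3 : (n : ℤ) * ((b ν : ℤ) - (b' ν : ℤ)) + ((((z ν).val % n : ℕ) : ℤ) - (((z' ν).val % n : ℕ) : ℤ))
      = ((z ν).val : ℤ) - ((z' ν).val : ℤ) := by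
    conv_rhs => rw [e1, e2]
    push_cast; ring
  rw [e3] at key
  have ht : |((((z ν).val % n : ℕ) : ℤ) - (((z' ν).val % n : ℕ) : ℤ))| ≤ (n : ℤ) - 1 := by
    rw [abs_le]; constructor <;> omega
  have e4 : circAbs (fine 1 M ν) ((b ν : ℤ) - (b' ν : ℤ)) = circAbs (M ν) ((b ν : ℤ) - (b' ν : ℤ)) := by
    rw [show (fine 1 M ν : ℕ) = M ν from one_mul _]
  rw [e4, show circAbs (fine n M ν) (((z ν).val : ℤ) - ((z' ν).val : ℤ)) = circAbs (n * M ν) (((z ν).val : ℤ) - ((z' ν).val : ℤ))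
    from rfl]
  linarith

omit hM in
/-- coordinatewise-to-sup transfer: if in EVERY coordinate `s·dist_{N₁}(x₀, x₀′) − c ≤ dist_{N₂}(y, y′)` (with `s, c ≥ 0`) then
`s·ldist_{N₁}(x₀, x₀′) − c ≤ ldist_{N₂}(y, y′)`. [folklore] -/
theorem le_ldist_of_coord {N₁ N₂ : Fin d → ℕ} [∀ ν, NeZero (N₁ ν)] [∀ ν, NeZero (N₂ ν)]
    (x₀ x₀' : Tor N₁) (y y' : Tor N₂) {s c : ℝ} (hc : 0 ≤ c)
    (h : ∀ ν, s * (circAbs (N₁ ν) (((x₀ ν).val : ℤ) - ((x₀' ν).val : ℤ)) : ℝ) - c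
      ≤ (circAbs (N₂ ν) (((y ν).val : ℤ) - ((y' ν).val : ℤ)) : ℝ)) :
    s * ldist N₁ x₀ x₀' - c ≤ ldist N₂ y y' := by
  have hN₁ : ∀ ν, 1 ≤ N₁ ν := fun ν => Nat.one_le_iff_ne_zero.mpr (NeZero.ne _)
  have hN₂ : ∀ ν, 1 ≤ N₂ ν := fun ν => Nat.one_le_iff_ne_zero.mpr (NeZero.ne _)
  have h0 : 0 ≤ ldist N₂ y y' := by unfold ldist; exact B4Sect5Torus.tdist_nonneg _ _ _
  rcases (Finset.univ : Finset (Fin d)).eq_empty_or_nonempty with hd | hd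
  · have : ldist N₁ x₀ x₀' = 0 := by  -- `d = 0`: both distances vanish
      unfold ldist tdist; rw [hd, Finset.sup_empty]; simp
    rw [this, mul_zero]; linarith
  · obtain ⟨ν₀, _, hν₀⟩ := Finset.exists_mem_eq_sup Finset.univ hd (ccoord N₁ (toSite N₁ x₀) (toSite N₁ x₀'))
    have e1 : ldist N₁ x₀ x₀' = (circAbs (N₁ ν₀) (((x₀ ν₀).val : ℤ) - ((x₀' ν₀).val : ℤ)) : ℝ) := by
      unfold ldist tdist
      rw [hν₀]
      have := B4Sect5Torus.ccoord_cast hN₁ (toSite N₁ x₀) (toSite N₁ x₀') ν₀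
      exact_mod_cast this
    rw [e1]
    exact (h ν₀).trans (circAbs_le_tdist hN₂ (toSite N₂ y) (toSite N₂ y') ν₀)

end Torus

/-! ## §2 The support of the rows of the composite averaging `Atow QBlev k` -/

section Support

variable (L : ℕ) [NeZero L] (M : Fin d → ℕ) [hM : ∀ μ, NeZero (M μ)]

/-- **row support**: an entry `(Atow QBlev k)_{(x₀,μ),(y,ν)} ≠ 0` forces `ν = μ` and `y − t e_μ ∈ B^{n_k}(x₀)` for some
`t < n_k` (read off `Atow_QBlev_apply`, [B5] (1.18) bond by bond). [folklore] -/
theorem Atow_apply_ne_zero (k : ℕ) (i : idx L M 0) (y : idx L M k) (h : Atow (QBlev L M) k i y ≠ 0) :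
    i.2 = y.2 ∧ ∃ t : Fin (lev L k), InBlock M (lev L k) (fun ν => (i.1 ν).val) (y.1 - tstep (fine (lev L k) M) i.2 (t : ℕ)) := by
  rw [Atow_QBlev_apply] at h
  by_cases hμ : i.2 = y.2
  · refine ⟨hμ, ?_⟩
    rw [if_pos hμ] at h
    have hlc : lineCount M (lev L k) (fun ν => (i.1 ν).val) i.2 y.1 ≠ 0 := fun h0 => h (by rw [h0, mul_zero])
    unfold lineCount at hlc
    obtain ⟨t, _, ht⟩ := Finset.exists_ne_zero_of_sum_ne_zero hlc
    exact ⟨t, by by_contra hnot; exact ht (if_neg hnot)⟩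
  · exact absurd (if_neg hμ) (fun h0 => h h0)

/-- **block-line separation**: if `y − t e_μ ∈ B^{n_k}(x₀)` and `y′ − t′ e_{μ′} ∈ B^{n_k}(x₀′)` with `t, t′ < n_k` (the
shape of the supports of two rows of `Atow QBlev k`) then `n_k·(ldist(x₀, x₀′) − 3) ≤ ldist(y, y′)` in `1/n_k`-units (block
separation + the two contour steps, each `< n_k`). [folklore] -/
theorem sep_of_inBlock (k : ℕ) (x₀ x₀' : Tor (fine (lev L 0) M)) (μ μ' : Fin d) (y y' : Tor (fine (lev L k) M))
    (t t' : ℕ) (htn : t < lev L k) (htn' : t' < lev L k)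
    (ht : InBlock M (lev L k) (fun ν => (x₀ ν).val) (y - tstep (fine (lev L k) M) μ t))
    (ht' : InBlock M (lev L k) (fun ν => (x₀' ν).val) (y' - tstep (fine (lev L k) M) μ' t')) :
    (lev L k : ℝ) * (ldist (fine (lev L 0) M) x₀ x₀' - 3) ≤ ldist (fine (lev L k) M) y y' := by
  have hn1 : 1 ≤ lev L k := one_le_lev' L k
  have hcoord : ∀ ν, (lev L k : ℝ) * (circAbs (fine (lev L 0) M ν) (((x₀ ν).val : ℤ) - ((x₀' ν).val : ℤ)) : ℝ) - 3 * ((lev L k : ℝ) - 1)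
      ≤ (circAbs (fine (lev L k) M ν) (((y ν).val : ℤ) - ((y' ν).val : ℤ)) : ℝ) := by
    intro ν
    have hNν : 1 ≤ fine (lev L k) M ν := Nat.one_le_iff_ne_zero.mpr (NeZero.ne _)
    set p : ℤ := ((((y - tstep (fine (lev L k) M) μ t) ν).val : ℤ)) with hp
    set p' : ℤ := ((((y' - tstep (fine (lev L k) M) μ' t') ν).val : ℤ)) with hp'
    have hA : circAbs (fine (lev L k) M ν) (((y ν).val : ℤ) - p) ≤ t := circAbs_val_sub_tstep_le _ y μ ν t
    have hC : circAbs (fine (lev L k) M ν) (p' - ((y' ν).val : ℤ)) ≤ t' := by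
      rw [show p' - ((y' ν).val : ℤ) = -(((y' ν).val : ℤ) - p') by ring, circAbs_neg hNν]
      exact circAbs_val_sub_tstep_le _ y' μ' ν t'
    have hB : (lev L k : ℤ) * circAbs (fine (lev L 0) M ν) (((x₀ ν).val : ℤ) - ((x₀' ν).val : ℤ)) - ((lev L k : ℤ) - 1)
        ≤ circAbs (fine (lev L k) M ν) (p - p') := block_sep_coord M (lev L k) hn1 ht ht' ν
    have h3 := circAbs_three_le hNν (((y ν).val : ℤ) - p) (p - p') (p' - ((y' ν).val : ℤ))
    rw [show ((y ν).val : ℤ) - p + (p - p') + (p' - ((y' ν).val : ℤ)) = ((y ν).val : ℤ) - ((y' ν).val : ℤ) by ring] at h3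
    have hZ : (lev L k : ℤ) * circAbs (fine (lev L 0) M ν) (((x₀ ν).val : ℤ) - ((x₀' ν).val : ℤ)) - 3 * ((lev L k : ℤ) - 1)
        ≤ circAbs (fine (lev L k) M ν) (((y ν).val : ℤ) - ((y' ν).val : ℤ)) := by
      have htn1 : (t : ℤ) ≤ (lev L k : ℤ) - 1 := by omega
      have htn1' : (t' : ℤ) ≤ (lev L k : ℤ) - 1 := by omega
      linarith
    have := (Int.cast_le (R := ℝ)).mpr hZ
    push_cast at this
    linarith
  have h := le_ldist_of_coord (N₁ := fine (lev L 0) M) (N₂ := fine (lev L k) M) x₀ x₀' y y'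
    (s := (lev L k : ℝ)) (c := 3 * ((lev L k : ℝ) - 1))
    (by have : (1 : ℝ) ≤ (lev L k : ℝ) := by exact_mod_cast hn1
        linarith) hcoord
  have hn0 : (0 : ℝ) ≤ (lev L k : ℝ) := Nat.cast_nonneg _
  nlinarith [h, hn0]

/-- the corner point `n_k·x₀` of the block of a unit-lattice site carries the site's row: `n_k·x₀ − 0·e_μ ∈ B^{n_k}(x₀)`.
[folklore] -/
theorem corner_inBlock (k : ℕ) (x₀ : Tor (fine (lev L 0) M)) (μ : Fin d) :
    InBlock M (lev L k) (fun ν => (x₀ ν).val)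
      ((fun ν => (((lev L k) * (x₀ ν).val : ℕ) : ZMod (fine (lev L k) M ν))) - tstep (fine (lev L k) M) μ 0) := by
  intro ν
  have hn : 0 < lev L k := one_le_lev' L k
  have hx : (x₀ ν).val < M ν := by
    have h := ZMod.val_lt (x₀ ν)
    have e : fine (lev L 0) M ν = M ν := one_mul _
    exact lt_of_lt_of_eq h e
  rw [B5Block118.tstep_zero, sub_zero]
  show (((lev L k * (x₀ ν).val : ℕ) : ZMod (fine (lev L k) M ν))).val / lev L k = (x₀ ν).val
  rw [ZMod.val_natCast, Nat.mod_eq_of_lt, Nat.mul_div_cancel_left _ hn]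
  show lev L k * (x₀ ν).val < lev L k * M ν
  exact Nat.mul_lt_mul_of_pos_left hx hn

end Support

/-! ## §3 The entries of `unitCovB k` as `ℓ²` pairings of two rows against `𝒢_k` -/

section Pairing

variable {m n : Type*} [Fintype m] [DecidableEq m] [Fintype n] [DecidableEq n]

omit [Fintype m] [DecidableEq m] [DecidableEq n] in
/-- the `(i, j)` entry of `A X Aᴴ` is the pairing of row `i` with `X` applied to the conjugate of row `j`. [folklore] -/
theorem sandwich_apply (A : Matrix m n ℂ) (X : Matrix n n ℂ) (i j : m) :
    (A * X * Aᴴ) i j = star (star (A i)) ⬝ᵥ (X *ᵥ star (A j)) := by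
  rw [star_star]
  simp only [Matrix.mul_apply, Matrix.conjTranspose_apply, dotProduct, Matrix.mulVec, Pi.star_apply,
    Finset.mul_sum, Finset.sum_mul]
  rw [Finset.sum_comm]
  refine Finset.sum_congr rfl fun x _ => Finset.sum_congr rfl fun y _ => ?_
  ring

/-- `‖row_i(A)‖₂² ≤ ‖A‖²` (the diagonal entry `(A Aᴴ)_{ii} = Σ_x |A_{ix}|²` is bounded by `‖A Aᴴ‖ ≤ ‖A‖·‖Aᴴ‖`). [folklore] -/
theorem nsq_row_le (A : Matrix m n ℂ) (i : m) : nsq (A i) ≤ ‖A‖ ^ 2 := by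
  classical
  have h1 : ((nsq (A i) : ℝ) : ℂ) = (A * Aᴴ) i i := by
    simp only [nsq, Matrix.mul_apply, Matrix.conjTranspose_apply]
    push_cast
    refine Finset.sum_congr rfl fun x _ => ?_
    rw [Complex.star_def, Complex.mul_conj, Complex.normSq_eq_norm_sq]
    push_cast
    ring
  have h2 : nsq (A i) = ‖(A * Aᴴ) i i‖ := by
    rw [← h1, Complex.norm_real, Real.norm_of_nonneg (nsq_nonneg _)]
  rw [h2]
  calc ‖(A * Aᴴ) i i‖ ≤ ‖A * Aᴴ‖ := norm_entry_le_opNorm _ _ _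
    _ ≤ ‖A‖ * ‖Aᴴ‖ := Matrix.l2_opNorm_mul _ _
    _ = ‖A‖ ^ 2 := by rw [Matrix.l2_opNorm_conjTranspose, sq]

omit [Fintype m] [DecidableEq m] [DecidableEq n] in
/-- `nsq (star v) = nsq v`. [folklore] -/
theorem nsq_star (v : n → ℂ) : nsq (star v) = nsq v := by
  simp [nsq]

/-- `√(nsq (star row_i(A))) ≤ ‖A‖`. [folklore] -/
theorem sqrt_nsq_star_row_le (A : Matrix m n ℂ) (i : m) : Real.sqrt (nsq (star (A i))) ≤ ‖A‖ := by
  rw [nsq_star]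
  calc Real.sqrt (nsq (A i)) ≤ Real.sqrt (‖A‖ ^ 2) := Real.sqrt_le_sqrt (nsq_row_le A i)
    _ = ‖A‖ := Real.sqrt_sq (norm_nonneg _)

end Pairing

/-! ## §4 The `k`-uniform decay and the decay-weighted Cauchy rate of the unit-lattice readings -/

section Decay

variable (a : ℝ) (ha : 0 < a)

/-- **THE `k`-UNIFORM POSITION-SPACE DECAY OF THE UNIT-LATTICE READINGS** of Bałaban's (1.18)-averaged free covariance at
`U = 1`: `∃ κ C > 0` depending on `(d, a)` only such that for every `L ≥ 1`, every torus with `M_μ ≥ 2`, every level `k` and all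
unit-lattice bonds `e, e′`, `‖(unitCovB k)_{e e′}‖ ≤ C·e^{−κ·ldist(e.1, e′.1)}` (sup torus distance of the unit lattice).  Route: §3
pairing of two rows (`ℓ²` norms `≤ ‖Atow‖`, supports `≥ n_k·(ldist − 3)` apart by §2) + the substrate's UNCONDITIONAL level-free
Combes–Thomas bound `CTVectorPropagatorLevelFree.calG_setDecay_levelFree` (auxiliary mass `a′ = 1`); `κ` EXISTENTIAL. [folklore] -/
theorem unitCovB_entry_decay :
    ∃ κ C : ℝ, 0 < κ ∧ 0 < C ∧ ∀ (L : ℕ) [NeZero L] (M : Fin d → ℕ) [∀ μ, NeZero (M μ)], (∀ μ, 2 ≤ M μ) →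
      ∀ (k : ℕ) (e e' : idx L M 0),
        ‖unitCovB L M a ha k e e'‖ ≤ C * Real.exp (-(κ * ldist (fine (lev L 0) M) e.1 e'.1)) := by
  obtain ⟨κ, C₀, hκ, hC₀, hdec⟩ := CTVectorPropagatorLevelFree.calG_setDecay_levelFree d a ha one_pos
  refine ⟨κ, C₀ * Real.exp (κ * 3), hκ, by positivity, ?_⟩
  intro L _ M _ hM2 k e e'
  classical
  set n := lev L k with hn
  have hn1 : 1 ≤ n := one_le_lev' L k
  set A := Atow (QBlev L M) k with hA
  have hent : unitCovB L M a ha k e e'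
      = ((((L : ℝ) ^ d : ℝ) : ℂ) ^ k) * (star (star (A e)) ⬝ᵥ (calGlev L M a ha k *ᵥ star (A e'))) := by
    show (avgTow (QBlev L M) ((L : ℝ) ^ d) (calGlev L M a ha) k) e e' = _
    rw [avgTow, Matrix.smul_apply, smul_eq_mul, sandwich_apply]
  have h2 : ∀ μ, 2 ≤ fine n M μ := fun μ =>
    le_trans (hM2 μ) (Nat.le_mul_of_pos_left (M μ) hn1)
  let T : Finset (Tor (fine n M)) := Finset.univ.filter fun s =>
    ∃ t : Fin n, InBlock M n (fun ν => (e'.1 ν).val) (s - tstep (fine n M) e'.2 (t : ℕ))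
  have hT : T.Nonempty := by
    refine ⟨fun ν => (((lev L k) * (e'.1 ν).val : ℕ) : ZMod (fine (lev L k) M ν)), ?_⟩
    rw [Finset.mem_filter]
    exact ⟨Finset.mem_univ _, ⟨0, hn1⟩, corner_inBlock L M k e'.1 e'.2⟩
  have hv : ∀ x : idx L M k, star (A e') x ≠ 0 → x.1 ∈ T := by
    intro x hx
    have hx' : A e' x ≠ 0 := fun h0 => hx (by rw [Pi.star_apply, h0, star_zero])
    obtain ⟨_, t, ht⟩ := Atow_apply_ne_zero L M k e' x hx'
    rw [Finset.mem_filter]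
    exact ⟨Finset.mem_univ _, t, ht⟩
  have hu : ∀ x : idx L M k, star (A e) x ≠ 0 → ∀ s ∈ T,
      (n : ℝ) * (ldist (fine (lev L 0) M) e.1 e'.1 - 3) ≤ ldist (fine n M) x.1 s := by
    intro x hx s hs
    have hx' : A e x ≠ 0 := fun h0 => hx (by rw [Pi.star_apply, h0, star_zero])
    obtain ⟨_, t, ht⟩ := Atow_apply_ne_zero L M k e x hx'
    rw [Finset.mem_filter] at hs
    obtain ⟨_, t', ht'⟩ := hs
    exact sep_of_inBlock L M k e.1 e'.1 e.2 e'.2 x.1 s t t' t.isLt t'.isLt ht ht'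
  have key := hdec n M h2 T hT (u := star (A e)) (v := star (A e'))
    (r := ldist (fine (lev L 0) M) e.1 e'.1 - 3) hv hu
  have hLd : (0 : ℝ) < (L : ℝ) ^ d := pow_pos (by exact_mod_cast Nat.pos_of_ne_zero (NeZero.ne L)) d
  have hAsq : ‖A‖ ^ 2 ≤ ((((L : ℝ) ^ d) ^ k))⁻¹ := opNorm_Atow_sq_le (QBlev L M) hLd (opNorm_QBlev_sq_le L M) k
  have hrows : Real.sqrt (nsq (star (A e))) * Real.sqrt (nsq (star (A e'))) ≤ ((((L : ℝ) ^ d) ^ k))⁻¹ :=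
    calc Real.sqrt (nsq (star (A e))) * Real.sqrt (nsq (star (A e')))
        ≤ ‖A‖ * ‖A‖ := mul_le_mul (sqrt_nsq_star_row_le A e) (sqrt_nsq_star_row_le A e') (Real.sqrt_nonneg _)
          (norm_nonneg _)
      _ = ‖A‖ ^ 2 := (sq _).symm
      _ ≤ _ := hAsq
  have hscal : ‖((((L : ℝ) ^ d : ℝ) : ℂ) ^ k)‖ = ((L : ℝ) ^ d) ^ k := by
    rw [norm_pow, Complex.norm_real, Real.norm_of_nonneg hLd.le]
  have hpair : ‖star (star (A e)) ⬝ᵥ (calGlev L M a ha k *ᵥ star (A e'))‖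
      ≤ C₀ * Real.exp (-(κ * (ldist (fine (lev L 0) M) e.1 e'.1 - 3))) * ((((L : ℝ) ^ d) ^ k))⁻¹ :=
    key.trans (mul_le_mul_of_nonneg_left hrows (by positivity))
  rw [hent, norm_mul, hscal]
  have hLk : (0 : ℝ) < ((L : ℝ) ^ d) ^ k := pow_pos hLd k
  calc ((L : ℝ) ^ d) ^ k * ‖star (star (A e)) ⬝ᵥ (calGlev L M a ha k *ᵥ star (A e'))‖
      ≤ ((L : ℝ) ^ d) ^ k * (C₀ * Real.exp (-(κ * (ldist (fine (lev L 0) M) e.1 e'.1 - 3))) * ((((L : ℝ) ^ d) ^ k))⁻¹) :=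
        mul_le_mul_of_nonneg_left hpair hLk.le
    _ = C₀ * Real.exp (κ * 3) * Real.exp (-(κ * ldist (fine (lev L 0) M) e.1 e'.1)) := by
        rw [show -(κ * (ldist (fine (lev L 0) M) e.1 e'.1 - 3)) = κ * 3 + -(κ * ldist (fine (lev L 0) M) e.1 e'.1) by ring,
          Real.exp_add]
        field_simp

/-- **THE DECAY-WEIGHTED CAUCHY RATE FROM ANY SUP-NORM CAUCHY RATE, rate a PARAMETER `θ`** (gan24-idea-1's request, ROUTES-GAN24
v2 §3: «carry the rate as a parameter θ in the END … a later sharpening should re-instantiate, not re-type»): with the `κ, C` of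
`unitCovB_entry_decay` (depending on `(d, a)` only), on every torus with `M_μ ≥ 2`: the uniform decay holds, AND for every `θ, ε ≥ 0`, an
entrywise Cauchy rate `‖(unitCovB (k+j) − unitCovB k) e e′‖ ≤ ε·θ^k` upgrades to the (O-pos) shape «`|𝒦_{k+j} − 𝒦_k|(x,y) ≤ C′θ′^k e^{−δ|x−y|}`»
(`ROUTES-GAN24.md` §0 (0.3)) with `C′ = √(2Cε)`, `θ′ = √θ`, `δ = κ/2` — King's `min ≤ geometric mean` (`King1986.CovarianceRate.abs_le_sqrt_mul_exp_half`).
Instances: `θ = L⁻¹`, `ε = 2·CQB` from NE2-p1's operator-norm rate (`GAN24/UnitCovDecayRate`); the sharp `θ = L⁻²` of R1∕R2 would re-instantiate here. [folklore] -/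
theorem unitCovB_decayCauchy_of_supCauchy :
    ∃ κ C : ℝ, 0 < κ ∧ 0 < C ∧ ∀ (L : ℕ) [NeZero L] (M : Fin d → ℕ) [∀ μ, NeZero (M μ)], (∀ μ, 2 ≤ M μ) →
      (∀ (k : ℕ) (e e' : idx L M 0), ‖unitCovB L M a ha k e e'‖ ≤ C * Real.exp (-(κ * ldist (fine (lev L 0) M) e.1 e'.1))) ∧
      ∀ (θ ε : ℝ), 0 ≤ θ → 0 ≤ ε →
        (∀ (k j : ℕ) (e e' : idx L M 0), ‖(unitCovB L M a ha (k + j) - unitCovB L M a ha k) e e'‖ ≤ ε * θ ^ k) →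
        ∀ (k j : ℕ) (e e' : idx L M 0), ‖(unitCovB L M a ha (k + j) - unitCovB L M a ha k) e e'‖
          ≤ Real.sqrt (2 * C * ε) * Real.sqrt θ ^ k * Real.exp (-(κ / 2 * ldist (fine (lev L 0) M) e.1 e'.1)) := by
  obtain ⟨κ, C, hκ, hC, hdec⟩ := unitCovB_entry_decay a ha
  refine ⟨κ, C, hκ, hC, fun L _ M _ hM2 => ⟨hdec L M hM2, ?_⟩⟩
  intro θ ε hθ hε hsup k j e e'
  set D := unitCovB L M a ha (k + j) - unitCovB L M a ha k with hD
  set ℓ := ldist (fine (lev L 0) M) e.1 e'.1 with hℓ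
  have hεk : |‖D e e'‖| ≤ ε * θ ^ k := by rw [abs_of_nonneg (norm_nonneg _)]; exact hsup k j e e'
  have hA : |‖D e e'‖| ≤ 2 * C * Real.exp (-(κ * ℓ)) := by
    rw [abs_of_nonneg (norm_nonneg _), hD, Matrix.sub_apply]
    calc ‖unitCovB L M a ha (k + j) e e' - unitCovB L M a ha k e e'‖
        ≤ ‖unitCovB L M a ha (k + j) e e'‖ + ‖unitCovB L M a ha k e e'‖ := norm_sub_le _ _
      _ ≤ C * Real.exp (-(κ * ℓ)) + C * Real.exp (-(κ * ℓ)) := add_le_add (hdec L M hM2 (k + j) e e') (hdec L M hM2 k e e')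
      _ = 2 * C * Real.exp (-(κ * ℓ)) := by ring
  have hK := King1986.abs_le_sqrt_mul_exp_half (mul_nonneg hε (pow_nonneg hθ k)) hεk hA
  rw [abs_of_nonneg (norm_nonneg _)] at hK
  have hsp : Real.sqrt (θ ^ k) = Real.sqrt θ ^ k := by  -- `√(θ^k) = (√θ)^k`
    rw [← Real.sqrt_sq (pow_nonneg (Real.sqrt_nonneg _) k), ← pow_mul, mul_comm, pow_mul, Real.sq_sqrt hθ]
  have hsq : Real.sqrt (ε * θ ^ k * (2 * C)) = Real.sqrt (2 * C * ε) * Real.sqrt θ ^ k := by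
    rw [show ε * θ ^ k * (2 * C) = (2 * C * ε) * θ ^ k by ring, Real.sqrt_mul' _ (pow_nonneg hθ k), hsp]
  rwa [hsq] at hK

end Decay

end Summit.QuantumFields.BalabanUV.Beta.GAN24.UnitCovDecay

end
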